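import Literature.MathematicalPhysics.QuantumLattice.KomaPiFluxLongRangeOrderBound
import Literature.MathematicalPhysics.QuantumLattice.AnisotropicKLSCauchySchwarz
import Literature.Probability.LatticeModels.InfraredLongRangeOrder
import Literature.Probability.LatticeModels.LatticeGreenThreeCertificate
import Literature.Probability.LatticeModels.LatticeGreenDimensionMonotone
import HarnessLib

/-!
# Koma 2022, the lattice constant `I_d` of (6.24): `I²_{D,Λ} ≤ D·G_Λ(0) - 1 - 1/(8D) + 2/|Λ|`, hence
# `limsup_Λ I²_{D,Λ} ≤ D·R(D) - 1 - 1/(8D) ≤ 0.4864 < 1/2` in every dimension `D ≥ 3`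

T. Koma, *Nambu–Goldstone modes for superconducting lattice fermions*, arXiv:2201.13135 (2022)
[Koma2022], §6, (6.21), (6.24), (6.37)–(6.39) and the sentence after (6.36): "When the constant `I_d`,
which depends on the dimension `d`, satisfies `I_d < 1` in the infinite-volume limit, the long-range
order exists for a large `β` and a small `|κ|/g`. Our numerical computations show `I_3 = 0.68⋯` and
`I_4 = 0.44⋯`", followed by the convexity argument `I_d ≤ I_3` for `d ≥ 4`.

In this series' normalisation (`KomaPiFluxLongRangeOrderBound.lean`: the infrared constant is the
sharp Dyson–Lieb–Simon one, twice Koma's (6.11)) the threshold reads `I² < 1/2` for the finite-volume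
lattice sum `I²_{D,Λ} = idSq d L = (D|Λ|)⁻¹ Σ_{q≠0} {C_q}₊²/E_q` (`C_q = Σᵢcos qᵢ`, `E_q = Σᵢ(1 - cos qᵢ)
= D - C_q`, `D = d + 1` directions, `|Λ| = L^D`). This file replaces Koma's numerical evaluation by a
PROOF, valid in every dimension `D ≥ 3` at once, through the lattice Green function at the origin
`R(D) = latticeGreen 0 = (2π)^{-D}∫ dq/E_q` (Watson's constant for `D = 3`) and its kernel-checked
enclosures already in the tree:

* `idSq_le_torusGreen` — the finite-volume inequality, on every even torus of side `L = 2k ≥ 4`: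
  `I²_{D,Λ} ≤ D·G_Λ(0) - 1 + 2/|Λ| - 1/(8D)`, `G_Λ(0) = torusGreen 0 = |Λ|⁻¹Σ_{q≠0} 1/E_q`.
  Proof: `{C}₊² = C² - {-C}₊²`; `Σ_{q≠0} C_q²/E_q = D²Σ_{q≠0}E_q⁻¹ - D|Λ| + 2D` exactly (`C = D - E`,
  `Σ_q E_q = D|Λ|`); and `Σ_{q≠0}{-C_q}₊²/E_q ≥ Σ_q{-C_q}₊²/(2D) = |Λ|/8`, because `E_q ≤ 2D` and, on the
  even torus, the half-period shift `q ↦ q + (π,…,π)` flips every cosine, so `Σ_q{-C_q}₊² = Σ_q{C_q}₊² =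
  ½Σ_q C_q² = D|Λ|/4` (orthogonality of the cosines; `AnisotropicKLSCauchySchwarz.lean`);
* `thermalSum_le` — the thermal sum of (6.21): `Σ_{q≠0}{C_q}₊/E_q ≤ D|Λ|·G_Λ(0)`;
* `idSq_eventually_le`, `thermalSum_div_eventually_le` — along the even sides, `D ≥ 3`:
  `I²_{D,Λ} ≤ D·R(D) - 1 - 1/(8D) + ε` and `(D|Λ|)⁻¹Σ_{q≠0}{C_q}₊/E_q ≤ R(D) + 1` eventually
  (`torusGreen_tendsto_latticeGreen`);
* `dim_mul_latticeGreen_sub_le` — **`D·R(D) - 1 - 1/(8D) ≤ 0.4864` for every `D ≥ 3`**: for `D = 3`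
  from `3R(3) ≤ 1.528` (`three_mul_latticeGreen_three_zero_le`, Watson's `3R(3) = 1.5164`), for `D ≥ 4`
  from `D·R(D) ≤ 4R(4) ≤ 1.2413` (Salmhofer–Seiler's monotonicity `dim_mul_latticeGreen_zero_le_of_le`
  and `four_mul_latticeGreen_four_zero_le`);
* **`idSq_eventually_le_const`** — consequently `I²_{D,Λ} ≤ 0.487 < 1/2` for all large even `L`, in
  every dimension `D = d + 1 ≥ 3`: the numerical hypothesis of Koma's Theorem 2.1 holds (with room:
  the true limits are `I_3² = 0.462`, `I_4² = 0.194`).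

Deviation from the printed road, recorded: Koma evaluates `I_3`, `I_4` numerically and proves
`I_d ≤ I_3` (`d ≥ 4`) by convexity of `s²/(1-s)` ((6.37)–(6.39)); here the elementary majorant
`{C}₊²/E ≤ C²/E - {-C}₊²/(2D)` reduces everything to the single constant `R(D)`, which the tree bounds
in all dimensions (Salmhofer–Seiler 1991, Prop. A.6). No named fact, no new definition.

## References

* [Koma2022] T. Koma, arXiv:2201.13135, (6.21), (6.24), (6.34)–(6.39).
* [KLS1988PRL] T. Kennedy, E. H. Lieb, B. S. Shastry, Phys. Rev. Lett. 61 (1988) 2582, eqs. (6)–(8)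
  (orthogonality of the cosines, sums versus integrals).
* [SalmhoferSeiler1991] M. Salmhofer, E. Seiler, Commun. Math. Phys. 139 (1991) 395, Prop. A.6, table
  p. 430 (`R(3)`, `R(4)`).
-/

noncomputable section

namespace Literature.MathematicalPhysics.QuantumLattice

open Finset Filter Topology
open Literature.Probability.LatticeModels

namespace KomaPiFlux

variable {D : ℕ}

/-! ### Trigonometric sums on the dual torus -/

section TrigSums

variable (L : ℕ) [NeZero L]

omit [NeZero L] in
/-- `C_K ≡ C` for unit couplings: `anisoCosSum 1 (p_q) = torusCosSum L q` (plumbing). [folklore] -/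
private theorem anisoCosSum_one_eq (q : TorusSite D L) :
    anisoCosSum (fun _ : Fin D => (1 : ℝ)) (latticeMomentum L q) = torusCosSum L q := by
  simp [anisoCosSum, torusCosSum]

/-- `Σ_q cos qᵢ = 0` on the dual torus of side `L ≥ 2` (orthogonality of characters).
[cite: KLS1988PRL, eq. (6)] -/
theorem sum_cos_latticeMomentum (hL : 2 ≤ L) (i : Fin D) :
    ∑ q : TorusSite D L, Real.cos (latticeMomentum L q i) = 0 := by
  haveI : Fact (1 < L) := ⟨by omega⟩
  have hne : (Pi.single i (1 : ZMod L) : TorusSite D L) ≠ 0 := by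
    intro h
    have h' := congrFun h i
    rw [Pi.single_eq_same, Pi.zero_apply] at h'
    exact one_ne_zero h'
  calc ∑ q : TorusSite D L, Real.cos (latticeMomentum L q i)
      = ∑ q : TorusSite D L, Real.cos (torusPhase L q (Pi.single i 1)) :=
        sum_congr rfl fun q _ => by rw [← torusChar_re, torusChar_single_re]
    _ = 0 := by rw [sum_cos_torusPhase, if_neg hne]

/-- `Σ_q C_q = 0` (`L ≥ 2`). [cite: KLS1988PRL, eq. (6)] -/
theorem sum_torusCosSum (hL : 2 ≤ L) : ∑ q : TorusSite D L, torusCosSum L q = 0 := by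
  unfold torusCosSum
  rw [sum_comm]
  exact sum_eq_zero fun i _ => sum_cos_latticeMomentum L hL i

/-- `Σ_q E_q = D|Λ|` (`L ≥ 2`). [cite: KLS1988PRL, eq. (6)] -/
theorem sum_dispersion_latticeMomentum (hL : 2 ≤ L) :
    ∑ q : TorusSite D L, dispersion (latticeMomentum L q) = D * (L : ℝ) ^ D := by
  have h : ∀ q : TorusSite D L, dispersion (latticeMomentum L q) = D - torusCosSum L q := fun q => by
    have h := sum_const_sub_mul_cos_latticeMomentum L q 1 1
    simp only [one_mul, mul_one] at h
    exact h
  simp_rw [h, sum_sub_distrib, sum_torusCosSum L hL, sub_zero, sum_const, card_univ, nsmul_eq_mul]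
  rw [show (Fintype.card (TorusSite D L) : ℝ) = (L : ℝ) ^ D by
    rw [Fintype.card_pi, prod_const, card_univ, ZMod.card, Fintype.card_fin, Nat.cast_pow], mul_comm]

/-- `Σ_q C_q² = ½D|Λ|` (`L ≥ 3`). [cite: KLS1988PRL, eq. (6)] -/
theorem sum_torusCosSum_sq (hL : 3 ≤ L) :
    ∑ q : TorusSite D L, torusCosSum L q ^ 2 = (L : ℝ) ^ D / 2 * D := by
  have h := sum_anisoCosSum_sq L hL (fun _ : Fin D => (1 : ℝ))
  simp_rw [anisoCosSum_one_eq] at h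
  rw [h]
  simp

end TrigSums

/-- `Σ_q {-C_q}₊² = ¼D|Λ|` on the torus of even side `2k ≥ 4` (`{x}₊² + {-x}₊² = x²` and
`Σ_q{C_q}₊² = ¼D|Λ|` by the half-period shift). [cite: KLS1988PRL, eq. (6)] -/
theorem sum_negPart_torusCosSum_sq (k : ℕ) (hk : 2 ≤ k) [NeZero (2 * k)] :
    ∑ q : TorusSite D (2 * k), max (-torusCosSum (2 * k) q) 0 ^ 2 = ((2 * k : ℕ) : ℝ) ^ D / 4 * D := by
  have hpos := sum_posPart_anisoCosSum_sq k hk (fun _ : Fin D => (1 : ℝ))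
  have hsq := sum_torusCosSum_sq (D := D) (2 * k) (by omega)
  simp_rw [anisoCosSum_one_eq] at hpos
  have hpm : ∀ x : ℝ, max (-x) 0 ^ 2 = x ^ 2 - max x 0 ^ 2 := fun x => by
    rcases le_or_gt 0 x with hx | hx
    · rw [max_eq_left hx, max_eq_right (by linarith), zero_pow two_ne_zero, sub_self]
    · rw [max_eq_right hx.le, max_eq_left (by linarith), zero_pow two_ne_zero, sub_zero, neg_sq]
  simp_rw [hpm, sum_sub_distrib, hsq, hpos]
  simp only [sum_const, card_univ, Fintype.card_fin, nsmul_eq_mul, one_pow, mul_one]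
  ring

/-! ### The finite-volume inequality -/

section FiniteVolume

/-- Pointwise: `{-C_q}₊²/E_q ≥ {-C_q}₊²/(2D)` (`E_q = D - C_q ≤ 2D` where `C_q < 0`). [cite: Koma2022, (6.24)] -/
theorem negPart_sq_div_dispersion_ge (L : ℕ) (q : TorusSite D L) :
    max (-torusCosSum L q) 0 ^ 2 / (2 * D) ≤ max (-torusCosSum L q) 0 ^ 2 / dispersion (latticeMomentum L q) := by
  have hE : dispersion (latticeMomentum L q) = D - torusCosSum L q := by
    have h := sum_const_sub_mul_cos_latticeMomentum L q 1 1
    simp only [one_mul, mul_one] at h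
    exact h
  have hC : -(D : ℝ) ≤ torusCosSum L q := by
    unfold torusCosSum
    calc -(D : ℝ) = ∑ _i : Fin D, (-1 : ℝ) := by simp
      _ ≤ _ := sum_le_sum fun i _ => Real.neg_one_le_cos _
  rcases le_or_gt 0 (torusCosSum L q) with h0 | h0
  · rw [max_eq_right (by linarith), zero_pow two_ne_zero, zero_div, zero_div]
  · have hEpos : 0 < dispersion (latticeMomentum L q) := by rw [hE]; linarith
    exact div_le_div_of_nonneg_left (sq_nonneg _) hEpos (by rw [hE]; linarith)

/-- **The crude sum, exactly**: `Σ_{q≠0} C_q²/E_q = D²Σ_{q≠0}E_q⁻¹ - D|Λ| + 2D` (`L ≥ 2`; `C_q = D - E_q`,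
`Σ_qE_q = D|Λ|`). [cite: Koma2022, (6.24)] [cite: KLS1988PRL, eq. (6)] -/
theorem sum_cosSum_sq_div_dispersion (L : ℕ) [NeZero L] (hL : 2 ≤ L) :
    ∑ q ∈ (univ : Finset (TorusSite D L)).erase 0, torusCosSum L q ^ 2 / dispersion (latticeMomentum L q) =
      (D : ℝ) ^ 2 * ∑ q ∈ (univ : Finset (TorusSite D L)).erase 0, 1 / dispersion (latticeMomentum L q) -
        D * (L : ℝ) ^ D + 2 * D := by
  set s := (univ : Finset (TorusSite D L)).erase 0 with hs
  have hE : ∀ q : TorusSite D L, torusCosSum L q = D - dispersion (latticeMomentum L q) := fun q => by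
    have h := sum_const_sub_mul_cos_latticeMomentum L q 1 1
    simp only [one_mul, mul_one] at h
    rw [dispersion]
    linarith
  have h1 : ∀ q ∈ s, torusCosSum L q ^ 2 / dispersion (latticeMomentum L q) =
      (D : ℝ) ^ 2 * (1 / dispersion (latticeMomentum L q)) - 2 * D + dispersion (latticeMomentum L q) := by
    intro q hq
    have hpos : 0 < dispersion (latticeMomentum L q) := dispersion_latticeMomentum_pos (mem_erase.1 hq).1
    rw [hE q]
    field_simp
    ring
  rw [sum_congr rfl h1, sum_add_distrib, sum_sub_distrib, ← mul_sum, sum_const]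
  have hcard : (s.card : ℝ) = (L : ℝ) ^ D - 1 := by
    rw [hs, card_erase_of_mem (mem_univ _), card_univ, Fintype.card_pi, prod_const, card_univ, ZMod.card,
      Fintype.card_fin]
    have h1 : 1 ≤ L ^ D := Nat.one_le_pow _ _ (Nat.pos_of_ne_zero (NeZero.ne L))
    rw [Nat.cast_sub h1, Nat.cast_pow, Nat.cast_one]
  have hsumE : ∑ q ∈ s, dispersion (latticeMomentum L q) = D * (L : ℝ) ^ D := by
    rw [hs, sum_erase_eq_sub (mem_univ _), sum_dispersion_latticeMomentum L hL, latticeMomentum_zero,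
      dispersion_zero, sub_zero]
  rw [nsmul_eq_mul, hcard, hsumE]
  ring

/-- **The negative part**: `Σ_{q≠0}{-C_q}₊²/E_q ≥ |Λ|/8` on the torus of even side `2k ≥ 4`, `D ≥ 1`.
[cite: Koma2022, (6.24)] -/
theorem sum_negPart_sq_div_dispersion_ge (hD : 1 ≤ D) (k : ℕ) (hk : 2 ≤ k) [NeZero (2 * k)] :
    ((2 * k : ℕ) : ℝ) ^ D / 8 ≤
      ∑ q ∈ (univ : Finset (TorusSite D (2 * k))).erase 0,
        max (-torusCosSum (2 * k) q) 0 ^ 2 / dispersion (latticeMomentum (2 * k) q) := by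
  have hD0 : (0 : ℝ) < D := by exact_mod_cast hD
  have h0 : max (-torusCosSum (2 * k) (0 : TorusSite D (2 * k))) 0 ^ 2 / (2 * D) = 0 := by
    rw [torusCosSum_zero, max_eq_right (by linarith), zero_pow two_ne_zero, zero_div]
  calc ((2 * k : ℕ) : ℝ) ^ D / 8 = (∑ q : TorusSite D (2 * k), max (-torusCosSum (2 * k) q) 0 ^ 2) / (2 * D) := by
        rw [sum_negPart_torusCosSum_sq k hk]
        field_simp
        ring
    _ = ∑ q ∈ (univ : Finset (TorusSite D (2 * k))).erase 0, max (-torusCosSum (2 * k) q) 0 ^ 2 / (2 * D) := by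
        rw [sum_div, sum_erase_eq_sub (mem_univ _), h0, sub_zero]
    _ ≤ _ := sum_le_sum fun q _ => negPart_sq_div_dispersion_ge (2 * k) q

/-- **The lattice sum of (6.24), bounded**: on the torus of even side `2k ≥ 4`, `D ≥ 1`,
`Σ_{q≠0}{C_q}₊²/E_q ≤ D²Σ_{q≠0}E_q⁻¹ - D|Λ| + 2D - |Λ|/8`. [cite: Koma2022, (6.24)] -/
theorem sum_posPart_sq_div_dispersion_le (hD : 1 ≤ D) (k : ℕ) (hk : 2 ≤ k) [NeZero (2 * k)] :
    ∑ q ∈ (univ : Finset (TorusSite D (2 * k))).erase 0,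
        max (torusCosSum (2 * k) q) 0 ^ 2 / dispersion (latticeMomentum (2 * k) q) ≤
      (D : ℝ) ^ 2 * ∑ q ∈ (univ : Finset (TorusSite D (2 * k))).erase 0, 1 / dispersion (latticeMomentum (2 * k) q) -
        D * ((2 * k : ℕ) : ℝ) ^ D + 2 * D - ((2 * k : ℕ) : ℝ) ^ D / 8 := by
  have hpm : ∀ x : ℝ, max x 0 ^ 2 = x ^ 2 - max (-x) 0 ^ 2 := fun x => by
    rcases le_or_gt 0 x with hx | hx
    · rw [max_eq_left hx, max_eq_right (by linarith), zero_pow two_ne_zero, sub_zero]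
    · rw [max_eq_right hx.le, max_eq_left (by linarith), zero_pow two_ne_zero, neg_sq, sub_self]
  have h1 : ∑ q ∈ (univ : Finset (TorusSite D (2 * k))).erase 0,
        max (torusCosSum (2 * k) q) 0 ^ 2 / dispersion (latticeMomentum (2 * k) q) =
      ∑ q ∈ (univ : Finset (TorusSite D (2 * k))).erase 0,
        (torusCosSum (2 * k) q ^ 2 / dispersion (latticeMomentum (2 * k) q) -
          max (-torusCosSum (2 * k) q) 0 ^ 2 / dispersion (latticeMomentum (2 * k) q)) :=
    sum_congr rfl fun q _ => by rw [hpm, sub_div]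
  rw [h1, sum_sub_distrib, sum_cosSum_sq_div_dispersion (2 * k) (by omega)]
  linarith [sum_negPart_sq_div_dispersion_ge hD k hk]

variable {d : ℕ}

/-- **`I²_{D,Λ} ≤ D·G_Λ(0) - 1 + 2/|Λ| - 1/(8D)`** on the torus of even side `L = 2k ≥ 4` in `D = d + 1`
directions (`G_Λ(0) = torusGreen 0 = |Λ|⁻¹Σ_{q≠0}E_q⁻¹`). [cite: Koma2022, (6.24)] -/
theorem idSq_le_torusGreen (k : ℕ) (hk : 2 ≤ k) [NeZero (2 * k)] :
    idSq d (2 * k) ≤ (d + 1) * torusGreen (0 : TorusSite (d + 1) (2 * k)) - 1 +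
      2 / ((2 * k : ℕ) : ℝ) ^ (d + 1) - 1 / (8 * (d + 1)) := by
  set N : ℝ := ((2 * k : ℕ) : ℝ) ^ (d + 1) with hN
  have hNpos : 0 < N := by rw [hN]; positivity
  have hD : (0 : ℝ) < (d + 1 : ℝ) := by positivity
  set S := ∑ q ∈ (univ : Finset (TorusSite (d + 1) (2 * k))).erase 0,
    1 / dispersion (latticeMomentum (2 * k) q) with hS
  have hG : torusGreen (0 : TorusSite (d + 1) (2 * k)) = S / N := by
    rw [torusGreen_zero, hS, hN]
    simp_rw [one_div]
  have hmain := sum_posPart_sq_div_dispersion_le (D := d + 1) (by omega) k hk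
  have hcast : ((d + 1 : ℕ) : ℝ) = (d : ℝ) + 1 := by push_cast; ring
  rw [hcast] at hmain
  have hL : (((2 * k : ℕ) : ℝ)) = ((2 * k : ℕ) : ℝ) := rfl
  unfold idSq
  rw [show ((2 * k : ℕ) : ℝ) ^ (d + 1) = N from rfl] at *
  rw [div_le_iff₀ (by positivity), hG]
  have e : ((d + 1) * (S / N) - 1 + 2 / N - 1 / (8 * (d + 1))) * ((d + 1) * N) =
      (d + 1) ^ 2 * S - (d + 1) * N + 2 * (d + 1) - N / 8 := by
    field_simp
  rw [e]
  exact hmain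

/-- **The thermal sum of (6.21)**: `Σ_{q≠0}{C_q}₊/E_q ≤ D|Λ|·G_Λ(0)` (`{C_q}₊ ≤ D`). [cite: Koma2022, (6.21)] -/
theorem thermalSum_le (L : ℕ) [NeZero L] :
    thermalSum d L ≤ (d + 1) * (L : ℝ) ^ (d + 1) * torusGreen (0 : TorusSite (d + 1) L) := by
  have hL : (0 : ℝ) < (L : ℝ) ^ (d + 1) := by
    have : (0 : ℝ) < L := by exact_mod_cast Nat.pos_of_ne_zero (NeZero.ne L)
    positivity
  rw [torusGreen_zero]
  have e : (d + 1 : ℝ) * (L : ℝ) ^ (d + 1) *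
      ((∑ q ∈ (univ : Finset (TorusSite (d + 1) L)).erase 0, (dispersion (latticeMomentum L q))⁻¹) /
        (L : ℝ) ^ (d + 1)) =
      (d + 1 : ℝ) * ∑ q ∈ (univ : Finset (TorusSite (d + 1) L)).erase 0, (dispersion (latticeMomentum L q))⁻¹ := by
    field_simp
  rw [e, thermalSum, mul_sum]
  refine sum_le_sum fun q hq => ?_
  have hpos : 0 < dispersion (latticeMomentum L q) := dispersion_latticeMomentum_pos (mem_erase.1 hq).1
  rw [← div_eq_mul_inv]
  refine div_le_div_of_nonneg_right (max_le ?_ (by positivity)) hpos.le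
  have h := sum_le_sum (s := (univ : Finset (Fin (d + 1)))) fun i _ => Real.cos_le_one (latticeMomentum L q i)
  simp only [sum_const, card_univ, Fintype.card_fin, nsmul_eq_mul, mul_one] at h
  unfold torusCosSum
  push_cast at h ⊢
  linarith

end FiniteVolume

/-! ### Along the even sides: the infinite-volume constants -/

section Eventually

variable {d : ℕ}

/-- **`I²_{D,Λ} ≤ D·R(D) - 1 - 1/(8D) + ε` for all large even `L`** (`D = d + 1 ≥ 3`; `R(D) = latticeGreen 0`
and `G_Λ(0) → R(D)`, `torusGreen_tendsto_latticeGreen`). [cite: Koma2022, after (6.36) ("in the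
infinite-volume limit")] [cite: KLS1988PRL, before eq. (2)] -/
theorem idSq_eventually_le (hd : 2 ≤ d) {ε : ℝ} (hε : 0 < ε) :
    ∃ k₀ : ℕ, ∀ k : ℕ, k₀ ≤ k → ∀ [NeZero (2 * k)],
      idSq d (2 * k) ≤ (d + 1) * latticeGreen (0 : Site (d + 1)) - 1 - 1 / (8 * (d + 1)) + ε := by
  have hD : (0 : ℝ) < (d + 1 : ℝ) := by positivity
  obtain ⟨L₀, hL₀⟩ := torusGreen_tendsto_latticeGreen (d := d + 1) (by omega) 0 (ε := ε / (2 * (d + 1)))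
    (by positivity)
  -- `2/|Λ| ≤ ε/2` as soon as `|Λ| ≥ 4/ε`; `|Λ| = (2k)^{d+1} ≥ 2k`
  obtain ⟨M, hM⟩ := exists_nat_gt (4 / ε)
  refine ⟨max L₀ (max M 2), fun k hk _ => ?_⟩
  have hk2 : 2 ≤ k := le_trans (le_max_right _ _) ((le_max_right _ _).trans hk)
  have hkL : L₀ ≤ 2 * k := by omega
  have hkM : M ≤ k := le_trans (le_max_left _ _) ((le_max_right _ _).trans hk)
  have h := hL₀ (2 * k) (even_two_mul k) hkL
  have h0 : Torus.proj (2 * k) (0 : Site (d + 1)) = 0 := by funext i; simp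
  rw [h0, abs_le] at h
  have hN : (4 / ε : ℝ) < ((2 * k : ℕ) : ℝ) ^ (d + 1) := by
    have h2k : (M : ℝ) < ((2 * k : ℕ) : ℝ) := by exact_mod_cast (show M < 2 * k by omega)
    have h1 : (1 : ℝ) ≤ ((2 * k : ℕ) : ℝ) := by exact_mod_cast (show 1 ≤ 2 * k by omega)
    calc (4 / ε : ℝ) < M := hM
      _ < ((2 * k : ℕ) : ℝ) := h2k
      _ = ((2 * k : ℕ) : ℝ) ^ 1 := (pow_one _).symm
      _ ≤ ((2 * k : ℕ) : ℝ) ^ (d + 1) := pow_le_pow_right₀ h1 (by omega)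
  have hNpos : (0 : ℝ) < ((2 * k : ℕ) : ℝ) ^ (d + 1) := by positivity
  have h2N : 2 / ((2 * k : ℕ) : ℝ) ^ (d + 1) ≤ ε / 2 := by
    rw [div_le_iff₀ hNpos]
    rw [div_lt_iff₀ hε] at hN
    linarith
  have hG : (d + 1) * torusGreen (0 : TorusSite (d + 1) (2 * k)) ≤ (d + 1) * latticeGreen (0 : Site (d + 1)) + ε / 2 := by
    have h1 : (d + 1) * (torusGreen (0 : TorusSite (d + 1) (2 * k)) - latticeGreen (0 : Site (d + 1))) ≤
        (d + 1) * (ε / (2 * (d + 1))) := mul_le_mul_of_nonneg_left h.2 hD.le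
    have h2 : (d + 1) * (ε / (2 * (d + 1))) = ε / 2 := by field_simp
    linarith
  linarith [idSq_le_torusGreen (d := d) k hk2]

/-- **The thermal sum is `O(|Λ|)`**: `(D|Λ|)⁻¹Σ_{q≠0}{C_q}₊/E_q ≤ R(D) + 1` for all large even `L`
(`D = d + 1 ≥ 3`). [cite: Koma2022, (6.21)] [cite: KLS1988PRL, before eq. (2)] -/
theorem thermalSum_div_eventually_le (hd : 2 ≤ d) :
    ∃ k₀ : ℕ, ∀ k : ℕ, k₀ ≤ k → ∀ [NeZero (2 * k)],
      thermalSum d (2 * k) / ((d + 1) * ((2 * k : ℕ) : ℝ) ^ (d + 1)) ≤ latticeGreen (0 : Site (d + 1)) + 1 := by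
  obtain ⟨L₀, hL₀⟩ := torusGreen_tendsto_latticeGreen (d := d + 1) (by omega) 0 one_pos
  refine ⟨L₀ + 1, fun k hk _ => ?_⟩
  have h := hL₀ (2 * k) (even_two_mul k) (by omega)
  have h0 : Torus.proj (2 * k) (0 : Site (d + 1)) = 0 := by funext i; simp
  rw [h0, abs_le] at h
  have hN : (0 : ℝ) < (d + 1) * ((2 * k : ℕ) : ℝ) ^ (d + 1) := by
    have : (0 : ℝ) < ((2 * k : ℕ) : ℝ) := by exact_mod_cast (show 0 < 2 * k by omega)
    positivity
  rw [div_le_iff₀ hN]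
  have h1 := thermalSum_le (d := d) (2 * k)
  have h2 : (d + 1) * ((2 * k : ℕ) : ℝ) ^ (d + 1) * torusGreen (0 : TorusSite (d + 1) (2 * k)) ≤
      (d + 1) * ((2 * k : ℕ) : ℝ) ^ (d + 1) * (latticeGreen (0 : Site (d + 1)) + 1) :=
    mul_le_mul_of_nonneg_left (by linarith [h.2]) hN.le
  linarith

/-- **The constant, in every dimension**: `D·R(D) - 1 - 1/(8D) ≤ 0.4864` for `D ≥ 3` (`D = 3`:
`3R(3) ≤ 1.528`; `D ≥ 4`: `D·R(D) ≤ 4R(4) ≤ 1.2413` by Salmhofer–Seiler's monotonicity).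
[cite: SalmhoferSeiler1991, Prop. A.6, table p. 430] [cite: Koma2022, after (6.36)] -/
theorem dim_mul_latticeGreen_sub_le {D : ℕ} (hD : 3 ≤ D) :
    (D : ℝ) * latticeGreen (0 : Site D) - 1 - 1 / (8 * D) ≤ 4864 / 10000 := by
  rcases Nat.lt_or_ge D 4 with h3 | h4
  · have hD3 : D = 3 := by omega
    subst hD3
    have h := three_mul_latticeGreen_three_zero_le
    norm_num at h ⊢
    linarith
  · have hmono := dim_mul_latticeGreen_zero_le_of_le (d := 4) (d' := D) (by norm_num) h4
    have h4' := four_mul_latticeGreen_four_zero_le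
    have hD0 : (0 : ℝ) < D := by exact_mod_cast (show 0 < D by omega)
    have hpos : (0 : ℝ) < 1 / (8 * D) := by positivity
    push_cast at hmono
    linarith

/-- **Koma's numerical hypothesis, proved: `I²_{D,Λ} ≤ 0.487 < 1/2` for all large even `L`, in every
dimension `D = d + 1 ≥ 3`** (this series' threshold is `I² < 1/2`; the printed values are
`I_3² = 0.462`, `I_4² = 0.194`). [cite: Koma2022, Theorem 2.1, after (6.36)] -/
theorem idSq_eventually_le_const (hd : 2 ≤ d) :
    ∃ k₀ : ℕ, ∀ k : ℕ, k₀ ≤ k → ∀ [NeZero (2 * k)], idSq d (2 * k) ≤ 487 / 1000 := by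
  obtain ⟨k₀, hk₀⟩ := idSq_eventually_le hd (ε := 6 / 10000) (by norm_num)
  refine ⟨k₀, fun k hk _ => (hk₀ k hk).trans ?_⟩
  have h := dim_mul_latticeGreen_sub_le (D := d + 1) (by omega)
  push_cast at h
  linarith

end Eventually

end KomaPiFlux

end Literature.MathematicalPhysics.QuantumLattice

end
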